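import Summits.ABC.ABC.Theorems.IsogenyGlueCongruenceTorsionSharingPrimeBoundStubSameLevel
import Summits.ABC.ABC.Theorems.IsogenyGlueCongruenceDegreePrimesPolyBoundedNewPartFrame
import Literature.NumberTheory.EllipticCurves.NewformsCoeffFieldHolds
import Mathlib.RingTheory.Ideal.GoingUp
import HarnessLib

/-!
# Crux A `DegreePrimesPolyBounded` (stmt-ABC-2045), line `newpart-congruence-friability` — the socket
# of the line is EQUIVALENT to the crux (and to the same-level piece of crux K)

The frame of the line (`Theorems/IsogenyGlueCongruenceDegreePrimesPolyBoundedNewPartFrame.lean`)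
closes crux A from three pieces of known mathematics and ONE statement the bet has to supply, the
datum form `NewPartPrimesOfDatum` of new-part friability: *for a semistable globally minimal `W/ℚ` of
conductor `N`, a parametrisation datum `D` of `W` at level `N`, and a newform `g` of level `N` in
another Hecke orbit (`𝕀_g ≠ 𝕀_{f_W}`), every prime `ℓ ∣ η(f_W,[g]) = #𝕋_N/(𝕀_{f_W} + 𝕀_g)` is
`≤ C · N^κ`.*  This file proves the CONVERSE direction, so that the socket is pinned:

* `congruentAway_of_dvd_heckeCongruenceModulus` (UNCONDITIONAL) — **an anemic congruence prime is a
  coefficient congruence prime**: if `ℓ ∣ η(D.f,[g]) ≠ 0` then `f_W ≡ g` modulo a prime above `ℓ` of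
  the ring `ℤ̄ ⊂ ℂ` of all algebraic integers, in the coefficient form `CongruentAway W N g ℓ` of the
  K-line (`a_p(g) ↦ a_p(W) mod ℓ` for every prime `p ∤ Nℓ`).  Proof: a prime of `η ≠ 0` lies under a
  maximal ideal `𝔪 ∋ ℓ` of `𝕋 = ℤ[T_p : p ∤ N]` containing `𝕀_{f_W} + 𝕀_g`; the eigencharacter
  `χ_g : 𝕋 → ℂ` takes values in `ℤ̄` (`𝕋` is a finite `ℤ`-module) and has kernel `𝕀_g ⊆ 𝔪`, so by
  lying over (`Ideal.exists_ideal_over_maximal_of_isIntegral`, `ℤ̄` is integral over `χ_g(𝕋)`) there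
  is a maximal ideal `Q` of `ℤ̄` with `χ_g⁻¹(Q) = 𝔪`; in `ℤ̄/Q` (a field of characteristic `ℓ`)
  `a_p(g) = χ_g(T_p) ≡ a_p(W)` because `T_p − a_p(W) ∈ 𝕀_{f_W} ⊆ 𝔪`; the coefficients of `g` are
  algebraic integers (`IsNewform0.isIntegral_coeff_holds`) and `a_p(g)` IS the `T_p`-eigenvalue
  (`heckeEigenvalue_eq_coeff_of_isNormalized`), both THEOREMS of the tree.
* `newPartPrimesOfDatum_of_kSameLevel` (UNCONDITIONAL) — the same-level piece `KSameLevel` of crux K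
  (`TorsionSharingPrimeBound`, line `SketchIdeator3g2`) implies the socket of this line.
* `newPartPrimesOfDatum_of_degreePrimesPolyBounded` — crux A implies the socket, modulo the printed
  same-level inputs `SameLevelCongruenceFacts` of the K-line ((a) anemic congruence primes `ℓ ≥ 11`,
  `ℓ ∤ N` divide `r_f`; (b) `0 < r_f`; (c) the class-minimal degree divides every degree with the same
  newform; (d) ARS 2012 Thm 2.1 `ord_ℓ(r_f) = ord_ℓ(m_f)` for `ℓ² ∤ N`), through the landed
  `stub_sameLevel : DegreePrimesPolyBounded → SameLevelCongruenceFacts → KSameLevel`.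
* `degreePrimesPolyBounded_of_kSameLevel`, `newPartPrimesOfDatum_iff_degreePrimesPolyBounded`,
  `kSameLevel_iff_degreePrimesPolyBounded` — with the three known inputs of the frame (modularity with
  an integral Manin constant, Mazur–Kenku, the Galois input of the old-partner peeling) the three
  statements `NewPartPrimesOfDatum`, `KSameLevel`, `DegreePrimesPolyBounded` are EQUIVALENT.

Consequence for the line (lead's reading, not a theorem): the bet `stub_gradedNewPartFriability`, and
already its rank-one slice `RationalNewPartFriability`, imply the socket (landed reductions), hence are
AT LEAST AS STRONG AS THE CRUX modulo known mathematics; the line is a reformulation of crux A in E-free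
(Hecke-order) vocabulary plus a graded surplus, not a reduction of it to something smaller.
-/

set_option linter.dupNamespace false

noncomputable section

open scoped MatrixGroups ModularForm
open CongruenceSubgroup
open Literature.NumberTheory.EllipticCurves.ModularForms
open Summit.ABC.ABC.Theses.IsogenyGlueCongruence
open Summit.ABC.ABC.Theorems.IGCTorsionSharing

namespace Summit.ABC.ABC.Theorems.DegreePrimesPolyBounded

/-! ## Anemic congruence primes are coefficient congruence primes -/

section Congruence

variable {N : ℕ} [NeZero N] {k : ℤ}

/-- The values of the eigencharacter `χ_g : 𝕋 → ℂ` of a simultaneous eigenvector are algebraic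
integers: `𝕋 = ℤ[T_p : p ∤ N]` is a finite `ℤ`-module, so each `t ∈ 𝕋` is integral over `ℤ`, and
ring maps preserve integrality. [folklore] -/
theorem eigencharacter_mem_integralClosure {g : CuspForm (Gamma0 N) k} (hg : IsAnemicEigenvector g)
    (hg0 : g ≠ 0) (t : anemicHeckeRing N k) :
    eigencharacter hg hg0 t ∈ integralClosure ℤ ℂ :=
  (mem_integralClosure_iff (R := ℤ) (A := ℂ)).mpr
    (map_isIntegral_int _ (Algebra.IsIntegral.isIntegral (R := ℤ) t))

/-- For a newform `g`, the `p`-th Fourier coefficient is the value of the eigencharacter on `T_p`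
(`p ∤ N`): `a_p(g) = χ_g(T_p)` (`T_p g = a_p(g) g` for a normalised eigenform,
`heckeEigenvalue_eq_coeff_of_isNormalized`). [folklore] -/
theorem cuspCoeff_eq_eigencharacter_T {g : CuspForm (Gamma0 N) k} (hg : IsNewform0 g)
    (hg0 : g ≠ 0) (p : ℕ) [NeZero p] (hp : p.Prime) (hpN : ¬ p ∣ N) :
    cuspCoeff g p = eigencharacter hg.2.1.isAnemicEigenvector hg0 (anemicHeckeRing.T N k p hp hpN) := by
  rw [eigencharacter_T _ hg0 p hp hpN, heckeEigenvalue_eq_coeff_of_isNormalized hg.2.2 hp (hg.2.1 p hp)]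
  rfl

/-- **An anemic congruence prime is a coefficient congruence prime.** Let `D` be a parametrisation
datum of `W/ℚ` at level `N` (so `D.f` is the newform of `W`, `a_p(D.f) = a_p(W) ∈ ℤ`), `g` a newform of
level `N`, and `ℓ` a prime dividing Pasten's congruence modulus `η(D.f,[g]) = #𝕋/(𝕀_{D.f} + 𝕀_g) ≠ 0`.
Then `D.f ≡ g` modulo a prime above `ℓ` in the coefficient form `CongruentAway W N g ℓ`: there are a
subring `R ⊆ ℂ` containing every `aₙ(g)` (here the ring of all algebraic integers), a field `F` of
characteristic `ℓ` and `φ : R →+* F` with `φ(a_p(g)) = a_p(W)` for every prime `p ∤ N · N_W · ℓ`.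
Lying over for `χ_g(𝕋) ⊆ ℤ̄` applied to a maximal ideal `𝔪 ∋ ℓ` of `𝕋` above `𝕀_{D.f} + 𝕀_g`;
`T_p − a_p(W) ∈ 𝕀_{D.f} ⊆ 𝔪`. [folklore] -/
theorem congruentAway_of_dvd_heckeCongruenceModulus {W : WeierstrassCurve ℚ}
    (D : ModularParametrizationData W N) {g : CuspForm (Gamma0 N) 2} (hg : IsNewform0 g)
    {ℓ : ℕ} (hℓ : ℓ.Prime) (h0 : heckeCongruenceModulus D.f (eigenIdeal g) ≠ 0)
    (hdvd : ℓ ∣ heckeCongruenceModulus D.f (eigenIdeal g)) :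
    CongruentAway W N g ℓ := by
  classical
  -- a maximal ideal of `𝕋` above `ℓ` containing both eigen-ideals
  obtain ⟨𝔪, h𝔪, hf𝔪, hg𝔪, hℓ𝔪⟩ :=
    exists_isMaximal_of_prime_dvd_heckeCongruenceModulus D.f (eigenIdeal g) hℓ h0 hdvd
  have hgA : IsAnemicEigenvector g := hg.2.1.isAnemicEigenvector
  have hg0 : g ≠ 0 := newform_ne_zero hg
  -- the eigencharacter of `g`, corestricted to the algebraic integers `S = ℤ̄ ⊆ ℂ`
  set S : Subalgebra ℤ ℂ := integralClosure ℤ ℂ with hS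
  let χ : anemicHeckeRing N 2 →+* S :=
    (eigencharacter hgA hg0).codRestrict S (eigencharacter_mem_integralClosure hgA hg0)
  have hχ : ∀ t, ((χ t : S) : ℂ) = eigencharacter hgA hg0 t := fun _ ↦ rfl
  letI : Algebra (anemicHeckeRing N 2) S := χ.toAlgebra
  have halg : ∀ t, algebraMap (anemicHeckeRing N 2) S t = χ t := fun _ ↦ rfl
  haveI : Algebra.IsIntegral (anemicHeckeRing N 2) S :=
    ⟨fun x ↦ (Algebra.IsIntegral.isIntegral (R := ℤ) x).tower_top⟩
  -- `ker χ = 𝕀_g ⊆ 𝔪`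
  have hker : RingHom.ker (algebraMap (anemicHeckeRing N 2) S) ≤ 𝔪 := by
    intro t ht
    rw [RingHom.mem_ker, halg] at ht
    have ht' : eigencharacter hgA hg0 t = 0 := by rw [← hχ, ht]; rfl
    have : t ∈ eigenIdeal g := by
      rw [eigenIdeal_eq_ker_eigencharacter hgA hg0, RingHom.mem_ker]
      exact ht'
    exact hg𝔪 this
  -- lying over: a maximal ideal `Q` of `ℤ̄` with `χ⁻¹(Q) = 𝔪`
  haveI := h𝔪
  obtain ⟨Q, hQ, hQcomap⟩ := Ideal.exists_ideal_over_maximal_of_isIntegral 𝔪 hker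
  have hmemQ : ∀ t ∈ 𝔪, χ t ∈ Q := fun t ht ↦ by
    have : t ∈ Q.comap (algebraMap (anemicHeckeRing N 2) S) := hQcomap.symm ▸ ht
    rwa [Ideal.mem_comap, halg] at this
  haveI := hQ
  letI : Field (S ⧸ Q) := Ideal.Quotient.field Q
  -- `ℤ̄/Q` has characteristic `ℓ`
  have hℓQ : ((ℓ : ℕ) : S) ∈ Q := by
    have := hmemQ _ hℓ𝔪
    rwa [map_natCast] at this
  have hchar : CharP (S ⧸ Q) ℓ :=
    (CharP.charP_iff_prime_eq_zero hℓ).mpr (by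
      rw [← map_natCast (Ideal.Quotient.mk Q), Ideal.Quotient.eq_zero_iff_mem]
      exact hℓQ)
  -- the coefficients of `g` are algebraic integers
  have hcoef : ∀ n : ℕ, cuspCoeff g n ∈ S.toSubring := fun n ↦
    Subalgebra.mem_toSubring.mpr
      ((mem_integralClosure_iff (R := ℤ) (A := ℂ)).mpr (IsNewform0.isIntegral_coeff_holds hg n))
  refine ⟨S.toSubring, S ⧸ Q, inferInstance, hchar, Ideal.Quotient.mk Q, hcoef, fun p hp hpdiv ↦ ?_⟩
  haveI : NeZero p := ⟨hp.ne_zero⟩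
  have hpN : ¬ p ∣ N := fun h ↦ hpdiv ((h.mul_right _).mul_right _)
  -- `a_p(g) = χ(T_p)` in `ℤ̄`
  have e1 : (⟨cuspCoeff g p, hcoef p⟩ : S.toSubring) = χ (anemicHeckeRing.T N 2 p hp hpN) :=
    Subtype.ext (by rw [hχ]; exact cuspCoeff_eq_eigencharacter_T hg hg0 p hp hpN)
  -- `T_p - a_p(W) ∈ 𝕀_{D.f} ⊆ 𝔪`, so `χ(T_p) ≡ a_p(W)` modulo `Q`
  have e2 : χ (anemicHeckeRing.T N 2 p hp hpN) - χ ((W.LFunction p : ℤ) : anemicHeckeRing N 2) ∈ Q := by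
    rw [← map_sub]
    exact hmemQ _ (hf𝔪 (T_sub_lFunction_mem_eigenIdeal D p hp hpN))
  change Ideal.Quotient.mk Q (⟨cuspCoeff g p, hcoef p⟩ : S.toSubring) = ((W.LFunction p : ℤ) : S ⧸ Q)
  rw [e1, Ideal.Quotient.eq.mpr e2, map_intCast, map_intCast]

end Congruence

/-! ## The socket of the line from the same-level piece of crux K, and from crux A -/

/-- **`KSameLevel ⟹ NewPartPrimesOfDatum`** (unconditional): the same-level piece of crux K — a
coefficient congruence prime between `f_W` (`W` semistable, globally minimal, conductor `N`) and
another newform of level `N` is `≤ C N^κ` — gives the datum form of new-part friability, the socket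
of the frame of this line. The partner `g` is not the newform of `W` (else `g = D.f` by the
`q`-expansion principle and `𝕀_g = 𝕀_{D.f}`), `η(D.f,[g]) ≠ 0`
(`heckeCongruenceModulus_newform_ne_zero`), and `congruentAway_of_dvd_heckeCongruenceModulus`. -/
theorem newPartPrimesOfDatum_of_kSameLevel (hK : KSameLevel) :
    ∃ κ C : ℝ, ∀ (N : ℕ) [NeZero N] (W : WeierstrassCurve ℚ) [W.IsElliptic] [W.IsGloballyMinimal],
      W.IsSemistable ℤ → W.conductorNorm ℤ = N →
      ∀ (D : ModularParametrizationData W N) (g : CuspForm (Gamma0 N) 2), IsNewform0 g →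
        eigenIdeal g ≠ eigenIdeal D.f →
        ∀ ℓ : ℕ, ℓ.Prime → ℓ ∣ heckeCongruenceModulus D.f (eigenIdeal g) →
          (ℓ : ℝ) ≤ C * (N : ℝ) ^ κ := by
  obtain ⟨κ, C, -, hK⟩ := hK
  refine ⟨κ, C, fun N _ W _ _ hW hWN D g hg hne ℓ hℓ hdvd ↦ ?_⟩
  subst hWN
  have h0 : heckeCongruenceModulus D.f (eigenIdeal g) ≠ 0 :=
    heckeCongruenceModulus_newform_ne_zero D hg hne
  have hng : ¬ IsNewformOf W g := fun hWg ↦ hne (by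
    rw [eq_of_forall_cuspCoeff_eq_gamma0 (f := g) (g := D.f)
      fun n ↦ by rw [hWg.2 n, D.isNewformOf.2 n]])
  exact hK W hW g hg hng ℓ hℓ (congruentAway_of_dvd_heckeCongruenceModulus D hg hℓ h0 hdvd)

/-- REGISTERED STUB of the line (companion seat c2): `KSameLevel ⟹ NewPartPrimesOfDatum`, the
statement of `newPartPrimesOfDatum_of_kSameLevel` under its registered name. -/
theorem stub_newPartPrimesOfDatum_of_kSameLevel :
    KSameLevel →
    ∃ κ C : ℝ, ∀ (N : ℕ) [NeZero N] (W : WeierstrassCurve ℚ) [W.IsElliptic] [W.IsGloballyMinimal],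
      W.IsSemistable ℤ → W.conductorNorm ℤ = N →
      ∀ (D : ModularParametrizationData W N) (g : CuspForm (Gamma0 N) 2), IsNewform0 g →
        eigenIdeal g ≠ eigenIdeal D.f →
        ∀ ℓ : ℕ, ℓ.Prime → ℓ ∣ heckeCongruenceModulus D.f (eigenIdeal g) →
          (ℓ : ℝ) ≤ C * (N : ℝ) ^ κ :=
  newPartPrimesOfDatum_of_kSameLevel

/-- **Crux A ⟹ the socket of the line**, modulo the printed same-level inputs of the K-line
(`SameLevelCongruenceFacts`: anemic congruence primes divide `r_f`; `0 < r_f`; the class-minimal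
degree divides every degree with the same newform; ARS 2012 Thm 2.1), through the landed
`stub_sameLevel` and `newPartPrimesOfDatum_of_kSameLevel`. -/
theorem newPartPrimesOfDatum_of_degreePrimesPolyBounded (hF : SameLevelCongruenceFacts)
    (hA : DegreePrimesPolyBounded) :
    ∃ κ C : ℝ, ∀ (N : ℕ) [NeZero N] (W : WeierstrassCurve ℚ) [W.IsElliptic] [W.IsGloballyMinimal],
      W.IsSemistable ℤ → W.conductorNorm ℤ = N →
      ∀ (D : ModularParametrizationData W N) (g : CuspForm (Gamma0 N) 2), IsNewform0 g →
        eigenIdeal g ≠ eigenIdeal D.f →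
        ∀ ℓ : ℕ, ℓ.Prime → ℓ ∣ heckeCongruenceModulus D.f (eigenIdeal g) →
          (ℓ : ℝ) ≤ C * (N : ℝ) ^ κ :=
  newPartPrimesOfDatum_of_kSameLevel (stub_sameLevel hA hF)

/-! ## The equivalences -/

/-- **Crux A from the same-level piece of crux K** and the three known inputs of the frame
(modularity with integral Manin constant `ModularDatumExists`, Mazur–Kenku
`PastenShimura2024_minimalDegree_le_163_mul`, and the Galois input `hGal` of the old-partner peeling):
`KSameLevel` supplies the socket (`newPartPrimesOfDatum_of_kSameLevel`) and the frame
`degreePrimesPolyBounded_of_newPartPrimesOfDatum` does the rest (Pasten Thm 5.5 `stub_spectral`,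
Atkin–Lehner–Li `stub_minimalPrimes`, the peeling `stub_oldPartner_of`, `v_p(Δ_min) ≤ C N²`). -/
theorem degreePrimesPolyBounded_of_kSameLevel (hmod : ModularDatumExists)
    (hMK : PastenShimura2024_minimalDegree_le_163_mul)
    (hGal : ∀ (N : ℕ) [NeZero N] (W : WeierstrassCurve ℚ) [W.IsElliptic] [W.IsGloballyMinimal],
      W.IsSemistable ℤ → W.conductorNorm ℤ = N →
      ∀ (f : CuspForm (Gamma0 N) 2), IsNewformOf W f →
      ∀ (M : ℕ) [NeZero M] (hM : M ∣ N) (g : CuspForm (Gamma0 M) 2), IsNewform0 g →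
      ∀ (p ℓ : ℕ), p.Prime → ℓ.Prime → p ∣ N → ¬ p ∣ M → ¬ ℓ ∣ N → 11 ≤ ℓ →
      ∀ 𝔪 : Ideal (anemicHeckeRing N 2), 𝔪.IsMaximal → (ℓ : anemicHeckeRing N 2) ∈ 𝔪 →
        eigenIdeal f ≤ 𝔪 → eigenIdeal (toLevel0 hM 2 g) ≤ 𝔪 →
        ℓ ∣ (W.minimalDiscriminantNorm ℤ).factorization p)
    (hK : KSameLevel) : DegreePrimesPolyBounded :=
  degreePrimesPolyBounded_of_newPartPrimesOfDatum (fun W _ _ _ _ ↦ hmod W) hMK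
    stub_spectral stub_minimalPrimes (stub_oldPartner_of hGal)
    (discValuation_of_modularity_of_mazurKenku hmod hMK)
    (newPartPrimesOfDatum_of_kSameLevel hK)

/-- **The socket of the line is equivalent to crux A** modulo known mathematics: the three known
inputs of the frame (`hmod`, `hMK`, `hGal`) for `⟹`, the printed same-level inputs of the K-line
(`hF`) for `⟸`.  So every bet plugged into this socket — the graded new-part friability, its
rank-one slice, the small-separator engine of line `Sketch` — is at least as strong as the crux. -/
theorem newPartPrimesOfDatum_iff_degreePrimesPolyBounded (hmod : ModularDatumExists)
    (hMK : PastenShimura2024_minimalDegree_le_163_mul)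
    (hGal : ∀ (N : ℕ) [NeZero N] (W : WeierstrassCurve ℚ) [W.IsElliptic] [W.IsGloballyMinimal],
      W.IsSemistable ℤ → W.conductorNorm ℤ = N →
      ∀ (f : CuspForm (Gamma0 N) 2), IsNewformOf W f →
      ∀ (M : ℕ) [NeZero M] (hM : M ∣ N) (g : CuspForm (Gamma0 M) 2), IsNewform0 g →
      ∀ (p ℓ : ℕ), p.Prime → ℓ.Prime → p ∣ N → ¬ p ∣ M → ¬ ℓ ∣ N → 11 ≤ ℓ →
      ∀ 𝔪 : Ideal (anemicHeckeRing N 2), 𝔪.IsMaximal → (ℓ : anemicHeckeRing N 2) ∈ 𝔪 →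
        eigenIdeal f ≤ 𝔪 → eigenIdeal (toLevel0 hM 2 g) ≤ 𝔪 →
        ℓ ∣ (W.minimalDiscriminantNorm ℤ).factorization p)
    (hF : SameLevelCongruenceFacts) :
    (∃ κ C : ℝ, ∀ (N : ℕ) [NeZero N] (W : WeierstrassCurve ℚ) [W.IsElliptic] [W.IsGloballyMinimal],
      W.IsSemistable ℤ → W.conductorNorm ℤ = N →
      ∀ (D : ModularParametrizationData W N) (g : CuspForm (Gamma0 N) 2), IsNewform0 g →
        eigenIdeal g ≠ eigenIdeal D.f →
        ∀ ℓ : ℕ, ℓ.Prime → ℓ ∣ heckeCongruenceModulus D.f (eigenIdeal g) →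
          (ℓ : ℝ) ≤ C * (N : ℝ) ^ κ) ↔ DegreePrimesPolyBounded :=
  ⟨fun h7 ↦ degreePrimesPolyBounded_of_newPartPrimesOfDatum (fun W _ _ _ _ ↦ hmod W) hMK
      stub_spectral stub_minimalPrimes (stub_oldPartner_of hGal)
      (discValuation_of_modularity_of_mazurKenku hmod hMK) h7,
    newPartPrimesOfDatum_of_degreePrimesPolyBounded hF⟩

/-- **The same-level piece of crux K is equivalent to crux A** modulo the same known mathematics
(`degreePrimesPolyBounded_of_kSameLevel` and the landed `stub_sameLevel`). -/
theorem kSameLevel_iff_degreePrimesPolyBounded (hmod : ModularDatumExists)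
    (hMK : PastenShimura2024_minimalDegree_le_163_mul)
    (hGal : ∀ (N : ℕ) [NeZero N] (W : WeierstrassCurve ℚ) [W.IsElliptic] [W.IsGloballyMinimal],
      W.IsSemistable ℤ → W.conductorNorm ℤ = N →
      ∀ (f : CuspForm (Gamma0 N) 2), IsNewformOf W f →
      ∀ (M : ℕ) [NeZero M] (hM : M ∣ N) (g : CuspForm (Gamma0 M) 2), IsNewform0 g →
      ∀ (p ℓ : ℕ), p.Prime → ℓ.Prime → p ∣ N → ¬ p ∣ M → ¬ ℓ ∣ N → 11 ≤ ℓ →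
      ∀ 𝔪 : Ideal (anemicHeckeRing N 2), 𝔪.IsMaximal → (ℓ : anemicHeckeRing N 2) ∈ 𝔪 →
        eigenIdeal f ≤ 𝔪 → eigenIdeal (toLevel0 hM 2 g) ≤ 𝔪 →
        ℓ ∣ (W.minimalDiscriminantNorm ℤ).factorization p)
    (hF : SameLevelCongruenceFacts) :
    KSameLevel ↔ DegreePrimesPolyBounded :=
  ⟨degreePrimesPolyBounded_of_kSameLevel hmod hMK hGal, fun hA ↦ stub_sameLevel hA hF⟩

end Summit.ABC.ABC.Theorems.DegreePrimesPolyBounded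

end
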